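import Summits.ValiantsHypothesis.ValiantsHypothesis.Theorems.BarrierLeverPartitionMinorsChowTwoEdgeStep
import Summits.ValiantsHypothesis.ValiantsHypothesis.Theorems.BarrierLeverPartitionMinorsChowDoubleCoreEngine

/-!
# Route BarrierLever — Chow witnesses for partition minors (item 20172, CPM): the engine with ALL the
# seat's steps (locked ∧ unpeelable ∧ no leaf / edge / double / two-edge step)

Helper file (`--supports stmt-ValiantsHypothesis-20172`; cell valiant-natproofs, rung V4, 𝒟-side of
door (c); seat val-np-p4 gen 13).  Closes NO item.  Conventions of items 19717 / 20172 / 20195: a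
layout `(u, w)` of height `h` is HIT when some product of `h + h` affine forms has nonsingular
partition minor `det[coeff_{E (u i) (w j)} ∏ ℓ]`.

`chow_hit_of_twoEdgeCore` — the double-core engine (`chow_hit_of_doubleCore`) sharpened by the
two-edge step (`chow_twoEdgeStep`): **a minimal layout missed by all products of `h + h` affine
forms is injective, locked, unpeelable, of size `r ≥ h + 1`, admits no leaf step, no edge step, no
double step on either side, AND has no row coordinate with exactly two edges together with a column
coordinate with exactly two edges.**  (The `2 × 2` base layout of the two-edge step is hit by the
induction hypothesis itself, so the clause handed to the core prover is purely combinatorial.)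

Census (kit, exact / sampled): the two-edge clause disposes of `16 992` of the `21 600` `(4,7)`
cores (untouched by every earlier step), `2 640` of the `6 512` `(4,6)` survivors and about `20 %`
of the sampled `(5,7)` survivors (j283701).

WHAT THIS IS NOT: an organising principle (reduction), not a hit; nothing on items 20172 / 20195 /
19717 themselves, on crux stmt-ValiantsHypothesis-14610, or on `VP` versus `VNP`.
-/

set_option linter.dupNamespace false

namespace Summit.ValiantsHypothesis.ValiantsHypothesis.Theorems.BarrierLever.ChowFactor

open Finset MvPolynomial

noncomputable section

/-! ## 1. The two-edge step from succAbove-free data -/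

/-- Injectivity of a singly reduced family off two dropped indices. -/
theorem preimage_injective_of_injOn₂ {h r : ℕ} (a : Fin (h + 1)) (u : Fin (r + 2) → Finset (Fin (h + 1)))
    (v₁ : Fin (r + 2)) (v₂'' : Fin (r + 1))
    (hinj : Set.InjOn (fun i => (u i).erase a) {i | i ≠ v₁ ∧ i ≠ v₁.succAbove v₂''}) :
    Function.Injective fun k : Fin r =>
      (u (v₁.succAbove (v₂''.succAbove k))).preimage a.succAbove Fin.succAbove_right_injective.injOn := by
  intro k k' hkk
  have he := erase_eq_of_preimage_succAbove_eq a hkk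
  have hk : v₁.succAbove (v₂''.succAbove k) ∈ {i | i ≠ v₁ ∧ i ≠ v₁.succAbove v₂''} :=
    ⟨Fin.succAbove_ne v₁ _, fun e => Fin.succAbove_ne v₂'' k (Fin.succAbove_right_injective e)⟩
  have hk' : v₁.succAbove (v₂''.succAbove k') ∈ {i | i ≠ v₁ ∧ i ≠ v₁.succAbove v₂''} :=
    ⟨Fin.succAbove_ne v₁ _, fun e => Fin.succAbove_ne v₂'' k' (Fin.succAbove_right_injective e)⟩
  exact Fin.succAbove_right_injective (Fin.succAbove_right_injective (hinj hk hk' he))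

/-- The two base rows of two distinct edges in one direction are distinct after deleting the
direction. -/
theorem preimage_base_injective {h r : ℕ} (a : Fin (h + 1)) (u : Fin r → Finset (Fin (h + 1)))
    (hu : Function.Injective u) (v₀ v₀' v₁ v₂ : Fin r) (h12 : v₂ ≠ v₁) (ha₁ : a ∈ u v₁)
    (ha₂ : a ∈ u v₂) (hv₀ : u v₀ = (u v₁).erase a) (hv₀' : u v₀' = (u v₂).erase a) :
    Function.Injective fun k : Fin 2 =>
      (u (![v₀, v₀'] k)).preimage a.succAbove Fin.succAbove_right_injective.injOn := by
  have hne : (u v₀).preimage a.succAbove Fin.succAbove_right_injective.injOn ≠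
      (u v₀').preimage a.succAbove Fin.succAbove_right_injective.injOn := by
    intro e
    have he := erase_eq_of_preimage_succAbove_eq a e
    rw [hv₀, hv₀', Finset.erase_idem, Finset.erase_idem] at he
    have : u v₁ = u v₂ := by
      rw [← Finset.insert_erase ha₁, ← Finset.insert_erase ha₂, he]
    exact h12 (hu this).symm
  intro k l hkl
  fin_cases k <;> fin_cases l
  · rfl
  · exact absurd hkl hne
  · exact absurd hkl.symm hne
  · rfl

/-- The two-edge step from the engine's data (`u` = rows, `w` = columns). -/
theorem twoEdgeStep_of_data {h r R : ℕ}
    (ih : ∀ (h r : ℕ), r ≤ R → ∀ (u w : Fin r → Finset (Fin h)), Function.Injective u →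
      Function.Injective w →
      ∃ ℓ : Fin (h + h) → MvPolynomial (Fin (h + h)) ℂ, (∀ q, (ℓ q).totalDegree ≤ 1) ∧
        (Matrix.of fun i j : Fin r => coeff
          (∑ b ∈ u i, Finsupp.single (Fin.castAdd h b) 1 + ∑ d ∈ w j, Finsupp.single (Fin.natAdd h d) 1)
          (∏ q, ℓ q)).det ≠ 0)
    (hR : 2 ≤ R) (u w : Fin r → Finset (Fin h)) (hu : Function.Injective u) (hw : Function.Injective w)
    (hrR : r ≤ R + 2) (a c : Fin h) (v₀ v₀' v₁ v₂ j₀ j₀' j₁ j₂ : Fin r) (h12 : v₂ ≠ v₁)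
    (ha₁ : a ∈ u v₁) (ha₂ : a ∈ u v₂) (hv₀ : u v₀ = (u v₁).erase a) (hv₀' : u v₀' = (u v₂).erase a)
    (hj12 : j₂ ≠ j₁) (hj₀ : j₀ ≠ j₁) (hj₀' : j₀' ≠ j₁) (hj₀'₂ : j₀' ≠ j₂)
    (hc₁ : c ∈ w j₁) (hc₂ : c ∈ w j₂) (hw₀ : w j₀ = (w j₁).erase c) (hw₀' : w j₀' = (w j₂).erase c)
    (hinju : Set.InjOn (fun i => (u i).erase a) {i | i ≠ v₁ ∧ i ≠ v₂})
    (hinjw : Set.InjOn (fun j => (w j).erase c) {j | j ≠ j₁ ∧ j ≠ j₂}) :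
    ∃ ℓ : Fin (h + h) → MvPolynomial (Fin (h + h)) ℂ, (∀ q, (ℓ q).totalDegree ≤ 1) ∧
      (Matrix.of fun i j : Fin r => coeff
        (∑ b ∈ u i, Finsupp.single (Fin.castAdd h b) 1 + ∑ d ∈ w j, Finsupp.single (Fin.natAdd h d) 1)
        (∏ q, ℓ q)).det ≠ 0 := by
  classical
  obtain ⟨h'', rfl⟩ : ∃ h'', h = h'' + 1 := ⟨h - 1, by have := a.pos; omega⟩
  obtain ⟨r'', rfl⟩ : ∃ r'', r = r'' + 2 := ⟨r - 2, by
    have h1 := v₁.isLt; have h2 := v₂.isLt; have h3 : (v₂ : ℕ) ≠ v₁ := fun e => h12 (Fin.ext e)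
    omega⟩
  obtain ⟨v₂'', rfl⟩ := Fin.exists_succAbove_eq h12
  obtain ⟨j₂'', rfl⟩ := Fin.exists_succAbove_eq hj12
  exact chow_twoEdgeStep a c u w v₀ v₀' v₁ v₂'' j₀ j₀' j₁ j₂'' ha₁ ha₂ hv₀ hv₀' hj₀ hj₀' hj₀'₂ hc₁ hc₂
    hw₀ hw₀'
    (ih h'' r'' (by omega) _ _ (preimage_injective_of_injOn₂ a u v₁ v₂'' hinju)
      (preimage_injective_of_injOn₂ c w j₁ j₂'' hinjw))
    (ih h'' 2 hR _ _ (preimage_base_injective a u hu v₀ v₀' v₁ _ h12 ha₁ ha₂ hv₀ hv₀')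
      (preimage_base_injective c w hw j₀ j₀' j₁ _ hj12 hc₁ hc₂ hw₀ hw₀'))

/-! ## 2. The engine -/

/-- **ENGINE WITH ALL STEPS (bounded form).** -/
theorem chow_hit_of_twoEdgeCore_le
    (core : ∀ (h r : ℕ) (u w : Fin r → Finset (Fin h)), Function.Injective u → Function.Injective w →
      (∀ (a c : Fin h) (β γ : Bool),
        (Finset.univ.filter fun i => (a ∈ u i ↔ β = true)).card ≠
          (Finset.univ.filter fun j => (c ∈ w j ↔ γ = true)).card) →
      (∀ a c : Fin h, ¬ (Function.Injective (fun i => (u i).erase a) ∧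
        Function.Injective (fun j => (w j).erase c))) →
      h + 1 ≤ r →
      (∀ (a c : Fin h) (i₁ j₁ j₀ : Fin r), (∀ i, i ≠ i₁ → (a ∈ u i ↔ a ∉ u i₁)) → j₁ ≠ j₀ →
        w j₀ = (w j₁).erase c → ¬ Set.InjOn (fun j => (w j).erase c) {j | j ≠ j₁}) →
      (∀ (c a : Fin h) (j₁ i₁ i₀ : Fin r), (∀ j, j ≠ j₁ → (c ∈ w j ↔ c ∉ w j₁)) → i₁ ≠ i₀ →
        u i₀ = (u i₁).erase a → ¬ Set.InjOn (fun i => (u i).erase a) {i | i ≠ i₁}) →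
      (∀ (a c : Fin h) (i₁ i₀ j₁ j₀ : Fin r), i₁ ≠ i₀ → u i₀ = (u i₁).erase a → j₁ ≠ j₀ →
        w j₀ = (w j₁).erase c → ¬ (Set.InjOn (fun i => (u i).erase a) {i | i ≠ i₁} ∧
          Set.InjOn (fun j => (w j).erase c) {j | j ≠ j₁})) →
      (∀ (a a' c c' : Fin h) (i₀ v₁ v₂ j₀ j₀' j₁ j₂ : Fin r), a' ≠ a → c' ≠ c → v₁ ≠ i₀ → v₂ ≠ i₀ →
        v₂ ≠ v₁ → (a ∈ u v₁ ↔ a ∉ u i₀) → (a' ∈ u v₁ ↔ a' ∈ u i₀) → (a ∈ u v₂ ↔ a ∈ u i₀) →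
        (a' ∈ u v₂ ↔ a' ∉ u i₀) → ((u v₁).erase a).erase a' = ((u i₀).erase a).erase a' →
        ((u v₂).erase a).erase a' = ((u i₀).erase a).erase a' →
        j₀ ≠ j₁ → j₀' ≠ j₁ → j₀' ≠ j₂ → j₂ ≠ j₁ →
        ((w j₁).erase c).erase c' = ((w j₀).erase c).erase c' →
        ((w j₂).erase c).erase c' = ((w j₀').erase c).erase c' →
        ((if c ∈ w j₁ then (1 : ℂ) else 0) - (if c ∈ w j₀ then 1 else 0)) *
            ((if c' ∈ w j₂ then (1 : ℂ) else 0) - (if c' ∈ w j₀' then 1 else 0)) ≠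
          ((if c ∈ w j₂ then (1 : ℂ) else 0) - (if c ∈ w j₀' then 1 else 0)) *
            ((if c' ∈ w j₁ then (1 : ℂ) else 0) - (if c' ∈ w j₀ then 1 else 0)) →
        ¬ (Set.InjOn (fun i => ((u i).erase a).erase a') {i | i ≠ v₁ ∧ i ≠ v₂} ∧
          Set.InjOn (fun j => ((w j).erase c).erase c') {j | j ≠ j₁ ∧ j ≠ j₂})) →
      (∀ (c c' a a' : Fin h) (j₀ v₁ v₂ i₀ i₀' i₁ i₂ : Fin r), c' ≠ c → a' ≠ a → v₁ ≠ j₀ → v₂ ≠ j₀ →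
        v₂ ≠ v₁ → (c ∈ w v₁ ↔ c ∉ w j₀) → (c' ∈ w v₁ ↔ c' ∈ w j₀) → (c ∈ w v₂ ↔ c ∈ w j₀) →
        (c' ∈ w v₂ ↔ c' ∉ w j₀) → ((w v₁).erase c).erase c' = ((w j₀).erase c).erase c' →
        ((w v₂).erase c).erase c' = ((w j₀).erase c).erase c' →
        i₀ ≠ i₁ → i₀' ≠ i₁ → i₀' ≠ i₂ → i₂ ≠ i₁ →
        ((u i₁).erase a).erase a' = ((u i₀).erase a).erase a' →
        ((u i₂).erase a).erase a' = ((u i₀').erase a).erase a' →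
        ((if a ∈ u i₁ then (1 : ℂ) else 0) - (if a ∈ u i₀ then 1 else 0)) *
            ((if a' ∈ u i₂ then (1 : ℂ) else 0) - (if a' ∈ u i₀' then 1 else 0)) ≠
          ((if a ∈ u i₂ then (1 : ℂ) else 0) - (if a ∈ u i₀' then 1 else 0)) *
            ((if a' ∈ u i₁ then (1 : ℂ) else 0) - (if a' ∈ u i₀ then 1 else 0)) →
        ¬ (Set.InjOn (fun j => ((w j).erase c).erase c') {j | j ≠ v₁ ∧ j ≠ v₂} ∧
          Set.InjOn (fun i => ((u i).erase a).erase a') {i | i ≠ i₁ ∧ i ≠ i₂})) →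
      (∀ (a c : Fin h) (v₀ v₀' v₁ v₂ j₀ j₀' j₁ j₂ : Fin r), v₂ ≠ v₁ → a ∈ u v₁ → a ∈ u v₂ →
        u v₀ = (u v₁).erase a → u v₀' = (u v₂).erase a → j₂ ≠ j₁ → j₀ ≠ j₁ → j₀' ≠ j₁ → j₀' ≠ j₂ →
        c ∈ w j₁ → c ∈ w j₂ → w j₀ = (w j₁).erase c → w j₀' = (w j₂).erase c →
        ¬ (Set.InjOn (fun i => (u i).erase a) {i | i ≠ v₁ ∧ i ≠ v₂} ∧
          Set.InjOn (fun j => (w j).erase c) {j | j ≠ j₁ ∧ j ≠ j₂})) →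
      ∃ ℓ : Fin (h + h) → MvPolynomial (Fin (h + h)) ℂ, (∀ q, (ℓ q).totalDegree ≤ 1) ∧
        (Matrix.of fun i j : Fin r => coeff
          (∑ b ∈ u i, Finsupp.single (Fin.castAdd h b) 1 + ∑ d ∈ w j, Finsupp.single (Fin.natAdd h d) 1)
          (∏ q, ℓ q)).det ≠ 0)
    (R : ℕ) : ∀ (h r : ℕ), r ≤ R → ∀ (u w : Fin r → Finset (Fin h)), Function.Injective u →
      Function.Injective w →
      ∃ ℓ : Fin (h + h) → MvPolynomial (Fin (h + h)) ℂ, (∀ q, (ℓ q).totalDegree ≤ 1) ∧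
        (Matrix.of fun i j : Fin r => coeff
          (∑ b ∈ u i, Finsupp.single (Fin.castAdd h b) 1 + ∑ d ∈ w j, Finsupp.single (Fin.natAdd h d) 1)
          (∏ q, ℓ q)).det ≠ 0 := by
  classical
  induction R with
  | zero =>
    intro h r hr u w hu hw
    exact chowHits_of_size_le_three h r (by omega) u w hu hw
  | succ R ih =>
    intro h r hr u w hu hw
    rcases Nat.lt_or_ge r 4 with hr4 | hr4
    · exact chowHits_of_size_le_three h r (by omega) u w hu hw
    have hR2 : 2 ≤ R := by omega
    refine chow_hit_of_core_le (R + 1) ?_ h r hr u w hu hw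
    intro h' r' u' w' hr' hu' hw' hlk hpl hsz
    -- edge step
    by_cases hedge : ∃ (a c : Fin h') (i₁ i₀ j₁ j₀ : Fin r'), i₁ ≠ i₀ ∧ u' i₀ = (u' i₁).erase a ∧
        j₁ ≠ j₀ ∧ w' j₀ = (w' j₁).erase c ∧ Set.InjOn (fun i => (u' i).erase a) {i | i ≠ i₁} ∧
        Set.InjOn (fun j => (w' j).erase c) {j | j ≠ j₁}
    · obtain ⟨a, c, i₁, i₀, j₁, j₀, hi, hi₀, hj, hj₀, hinju, hinjw⟩ := hedge
      obtain ⟨h'', rfl⟩ : ∃ h'', h' = h'' + 1 := ⟨h' - 1, by have := a.pos; omega⟩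
      obtain ⟨r'', rfl⟩ : ∃ r'', r' = r'' + 1 := ⟨r' - 1, by have := i₁.pos; omega⟩
      exact chow_edgeStep a c u' w' i₁ i₀ j₁ j₀ hi (mem_of_edge u' hu' hi hi₀) hi₀ hj
        (mem_of_edge w' hw' hj hj₀) hj₀
        (ih h'' r'' (by omega) _ _ (preimage_succAbove_injective_of_injOn a u' i₁ hinju)
          (preimage_succAbove_injective_of_injOn c w' j₁ hinjw))
    -- leaf steps
    by_cases hrow : ∃ (a c : Fin h') (i₁ j₁ j₀ : Fin r'), (∀ i, i ≠ i₁ → (a ∈ u' i ↔ a ∉ u' i₁)) ∧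
        j₁ ≠ j₀ ∧ w' j₀ = (w' j₁).erase c ∧ Set.InjOn (fun j => (w' j).erase c) {j | j ≠ j₁}
    · obtain ⟨a, c, i₁, j₁, j₀, hlone, hj, hj₀, hinj⟩ := hrow
      obtain ⟨h'', rfl⟩ : ∃ h'', h' = h'' + 1 := ⟨h' - 1, by have := a.pos; omega⟩
      obtain ⟨r'', rfl⟩ : ∃ r'', r' = r'' + 1 := ⟨r' - 1, by have := i₁.pos; omega⟩
      exact chow_leafStep a c u' w' i₁ j₁ j₀ hlone hj (mem_of_edge w' hw' hj hj₀) hj₀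
        (ih h'' r'' (by omega) _ _ (preimage_succAbove_injective_of_lonely a u' hu' i₁ hlone)
          (preimage_succAbove_injective_of_injOn c w' j₁ hinj))
    by_cases hcol : ∃ (c a : Fin h') (j₁ i₁ i₀ : Fin r'), (∀ j, j ≠ j₁ → (c ∈ w' j ↔ c ∉ w' j₁)) ∧
        i₁ ≠ i₀ ∧ u' i₀ = (u' i₁).erase a ∧ Set.InjOn (fun i => (u' i).erase a) {i | i ≠ i₁}
    · obtain ⟨c, a, j₁, i₁, i₀, hlone, hi, hi₀, hinj⟩ := hcol
      obtain ⟨h'', rfl⟩ : ∃ h'', h' = h'' + 1 := ⟨h' - 1, by have := a.pos; omega⟩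
      obtain ⟨r'', rfl⟩ : ∃ r'', r' = r'' + 1 := ⟨r' - 1, by have := i₁.pos; omega⟩
      refine chow_hit_swap u' w' ?_
      exact chow_leafStep c a w' u' j₁ i₁ i₀ hlone hi (mem_of_edge u' hu' hi hi₀) hi₀
        (ih h'' r'' (by omega) _ _ (preimage_succAbove_injective_of_lonely c w' hw' j₁ hlone)
          (preimage_succAbove_injective_of_injOn a u' i₁ hinj))
    -- double steps
    by_cases hd : ∃ (a a' c c' : Fin h') (i₀ v₁ v₂ j₀ j₀' j₁ j₂ : Fin r'), a' ≠ a ∧ c' ≠ c ∧ v₁ ≠ i₀ ∧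
        v₂ ≠ i₀ ∧ v₂ ≠ v₁ ∧ (a ∈ u' v₁ ↔ a ∉ u' i₀) ∧ (a' ∈ u' v₁ ↔ a' ∈ u' i₀) ∧
        (a ∈ u' v₂ ↔ a ∈ u' i₀) ∧ (a' ∈ u' v₂ ↔ a' ∉ u' i₀) ∧
        ((u' v₁).erase a).erase a' = ((u' i₀).erase a).erase a' ∧
        ((u' v₂).erase a).erase a' = ((u' i₀).erase a).erase a' ∧
        j₀ ≠ j₁ ∧ j₀' ≠ j₁ ∧ j₀' ≠ j₂ ∧ j₂ ≠ j₁ ∧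
        ((w' j₁).erase c).erase c' = ((w' j₀).erase c).erase c' ∧
        ((w' j₂).erase c).erase c' = ((w' j₀').erase c).erase c' ∧
        ((if c ∈ w' j₁ then (1 : ℂ) else 0) - (if c ∈ w' j₀ then 1 else 0)) *
            ((if c' ∈ w' j₂ then (1 : ℂ) else 0) - (if c' ∈ w' j₀' then 1 else 0)) ≠
          ((if c ∈ w' j₂ then (1 : ℂ) else 0) - (if c ∈ w' j₀' then 1 else 0)) *
            ((if c' ∈ w' j₁ then (1 : ℂ) else 0) - (if c' ∈ w' j₀ then 1 else 0)) ∧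
        Set.InjOn (fun i => ((u' i).erase a).erase a') {i | i ≠ v₁ ∧ i ≠ v₂} ∧
        Set.InjOn (fun j => ((w' j).erase c).erase c') {j | j ≠ j₁ ∧ j ≠ j₂}
    · obtain ⟨a, a', c, c', i₀, v₁, v₂, j₀, j₀', j₁, j₂, haa, hcc, hi₁, hi₂, h12, ha₁, ha'₁, ha₂, ha'₂,
        hlab₁, hlab₂, hj₀, hj₀', hj₀'₂, hj12, hcol₁, hcol₂, hδ, hinju, hinjw⟩ := hd
      exact doubleStep_of_data ih u' w' (by omega) a a' c c' i₀ v₁ v₂ j₀ j₀' j₁ j₂ haa hcc hi₁ hi₂ h12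
        ha₁ ha'₁ ha₂ ha'₂ hlab₁ hlab₂ hj₀ hj₀' hj₀'₂ hj12 hcol₁ hcol₂ hδ hinju hinjw
    by_cases hd' : ∃ (c c' a a' : Fin h') (j₀ v₁ v₂ i₀ i₀' i₁ i₂ : Fin r'), c' ≠ c ∧ a' ≠ a ∧ v₁ ≠ j₀ ∧
        v₂ ≠ j₀ ∧ v₂ ≠ v₁ ∧ (c ∈ w' v₁ ↔ c ∉ w' j₀) ∧ (c' ∈ w' v₁ ↔ c' ∈ w' j₀) ∧
        (c ∈ w' v₂ ↔ c ∈ w' j₀) ∧ (c' ∈ w' v₂ ↔ c' ∉ w' j₀) ∧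
        ((w' v₁).erase c).erase c' = ((w' j₀).erase c).erase c' ∧
        ((w' v₂).erase c).erase c' = ((w' j₀).erase c).erase c' ∧
        i₀ ≠ i₁ ∧ i₀' ≠ i₁ ∧ i₀' ≠ i₂ ∧ i₂ ≠ i₁ ∧
        ((u' i₁).erase a).erase a' = ((u' i₀).erase a).erase a' ∧
        ((u' i₂).erase a).erase a' = ((u' i₀').erase a).erase a' ∧
        ((if a ∈ u' i₁ then (1 : ℂ) else 0) - (if a ∈ u' i₀ then 1 else 0)) *
            ((if a' ∈ u' i₂ then (1 : ℂ) else 0) - (if a' ∈ u' i₀' then 1 else 0)) ≠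
          ((if a ∈ u' i₂ then (1 : ℂ) else 0) - (if a ∈ u' i₀' then 1 else 0)) *
            ((if a' ∈ u' i₁ then (1 : ℂ) else 0) - (if a' ∈ u' i₀ then 1 else 0)) ∧
        Set.InjOn (fun j => ((w' j).erase c).erase c') {j | j ≠ v₁ ∧ j ≠ v₂} ∧
        Set.InjOn (fun i => ((u' i).erase a).erase a') {i | i ≠ i₁ ∧ i ≠ i₂}
    · obtain ⟨c, c', a, a', j₀, v₁, v₂, i₀, i₀', i₁, i₂, hcc, haa, hi₁, hi₂, h12, ha₁, ha'₁, ha₂, ha'₂,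
        hlab₁, hlab₂, hj₀, hj₀', hj₀'₂, hj12, hcol₁, hcol₂, hδ, hinjw, hinju⟩ := hd'
      refine chow_hit_swap u' w' ?_
      exact doubleStep_of_data ih w' u' (by omega) c c' a a' j₀ v₁ v₂ i₀ i₀' i₁ i₂ hcc haa hi₁ hi₂ h12
        ha₁ ha'₁ ha₂ ha'₂ hlab₁ hlab₂ hj₀ hj₀' hj₀'₂ hj12 hcol₁ hcol₂ hδ hinjw hinju
    -- two-edge step
    by_cases hte : ∃ (a c : Fin h') (v₀ v₀' v₁ v₂ j₀ j₀' j₁ j₂ : Fin r'), v₂ ≠ v₁ ∧ a ∈ u' v₁ ∧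
        a ∈ u' v₂ ∧ u' v₀ = (u' v₁).erase a ∧ u' v₀' = (u' v₂).erase a ∧ j₂ ≠ j₁ ∧ j₀ ≠ j₁ ∧
        j₀' ≠ j₁ ∧ j₀' ≠ j₂ ∧ c ∈ w' j₁ ∧ c ∈ w' j₂ ∧ w' j₀ = (w' j₁).erase c ∧
        w' j₀' = (w' j₂).erase c ∧ Set.InjOn (fun i => (u' i).erase a) {i | i ≠ v₁ ∧ i ≠ v₂} ∧
        Set.InjOn (fun j => (w' j).erase c) {j | j ≠ j₁ ∧ j ≠ j₂}
    · obtain ⟨a, c, v₀, v₀', v₁, v₂, j₀, j₀', j₁, j₂, h12, ha₁, ha₂, hv₀, hv₀', hj12, hj₀, hj₀', hj₀'₂,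
        hc₁, hc₂, hw₀, hw₀', hinju, hinjw⟩ := hte
      exact twoEdgeStep_of_data ih hR2 u' w' hu' hw' (by omega) a c v₀ v₀' v₁ v₂ j₀ j₀' j₁ j₂ h12 ha₁
        ha₂ hv₀ hv₀' hj12 hj₀ hj₀' hj₀'₂ hc₁ hc₂ hw₀ hw₀' hinju hinjw
    -- no step available
    push Not at hedge hrow hcol hd hd' hte
    exact core h' r' u' w' hu' hw' hlk hpl hsz
      (fun a c i₁ j₁ j₀ hlone hj hj₀ => hrow a c i₁ j₁ j₀ hlone hj hj₀)
      (fun c a j₁ i₁ i₀ hlone hi hi₀ => hcol c a j₁ i₁ i₀ hlone hi hi₀)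
      (fun a c i₁ i₀ j₁ j₀ hi hi₀ hj hj₀ hboth => hedge a c i₁ i₀ j₁ j₀ hi hi₀ hj hj₀ hboth.1 hboth.2)
      (fun a a' c c' i₀ v₁ v₂ j₀ j₀' j₁ j₂ h1 h2 h3 h4 h5 h6 h7 h8 h9 h10 h11 h12 h13 h14 h15 h16 h17 h18
          hboth => hd a a' c c' i₀ v₁ v₂ j₀ j₀' j₁ j₂ h1 h2 h3 h4 h5 h6 h7 h8 h9 h10 h11 h12 h13 h14 h15 h16
          h17 h18 hboth.1 hboth.2)
      (fun c c' a a' j₀ v₁ v₂ i₀ i₀' i₁ i₂ h1 h2 h3 h4 h5 h6 h7 h8 h9 h10 h11 h12 h13 h14 h15 h16 h17 h18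
          hboth => hd' c c' a a' j₀ v₁ v₂ i₀ i₀' i₁ i₂ h1 h2 h3 h4 h5 h6 h7 h8 h9 h10 h11 h12 h13 h14 h15
          h16 h17 h18 hboth.1 hboth.2)
      (fun a c v₀ v₀' v₁ v₂ j₀ j₀' j₁ j₂ h1 h2 h3 h4 h5 h6 h7 h8 h9 h10 h11 h12' h13 hboth =>
        hte a c v₀ v₀' v₁ v₂ j₀ j₀' j₁ j₂ h1 h2 h3 h4 h5 h6 h7 h8 h9 h10 h11 h12' h13 hboth.1 hboth.2)

/-- **ENGINE WITH ALL STEPS.**  If every injective layout that is locked, unpeelable, of size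
`r ≥ h + 1`, admits no leaf step, no edge step, no double step (either side) and no two-edge step is
hit by a product of `h + h` affine forms, then every injective layout is hit. -/
theorem chow_hit_of_twoEdgeCore
    (core : ∀ (h r : ℕ) (u w : Fin r → Finset (Fin h)), Function.Injective u → Function.Injective w →
      (∀ (a c : Fin h) (β γ : Bool),
        (Finset.univ.filter fun i => (a ∈ u i ↔ β = true)).card ≠
          (Finset.univ.filter fun j => (c ∈ w j ↔ γ = true)).card) →
      (∀ a c : Fin h, ¬ (Function.Injective (fun i => (u i).erase a) ∧
        Function.Injective (fun j => (w j).erase c))) →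
      h + 1 ≤ r →
      (∀ (a c : Fin h) (i₁ j₁ j₀ : Fin r), (∀ i, i ≠ i₁ → (a ∈ u i ↔ a ∉ u i₁)) → j₁ ≠ j₀ →
        w j₀ = (w j₁).erase c → ¬ Set.InjOn (fun j => (w j).erase c) {j | j ≠ j₁}) →
      (∀ (c a : Fin h) (j₁ i₁ i₀ : Fin r), (∀ j, j ≠ j₁ → (c ∈ w j ↔ c ∉ w j₁)) → i₁ ≠ i₀ →
        u i₀ = (u i₁).erase a → ¬ Set.InjOn (fun i => (u i).erase a) {i | i ≠ i₁}) →
      (∀ (a c : Fin h) (i₁ i₀ j₁ j₀ : Fin r), i₁ ≠ i₀ → u i₀ = (u i₁).erase a → j₁ ≠ j₀ →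
        w j₀ = (w j₁).erase c → ¬ (Set.InjOn (fun i => (u i).erase a) {i | i ≠ i₁} ∧
          Set.InjOn (fun j => (w j).erase c) {j | j ≠ j₁})) →
      (∀ (a a' c c' : Fin h) (i₀ v₁ v₂ j₀ j₀' j₁ j₂ : Fin r), a' ≠ a → c' ≠ c → v₁ ≠ i₀ → v₂ ≠ i₀ →
        v₂ ≠ v₁ → (a ∈ u v₁ ↔ a ∉ u i₀) → (a' ∈ u v₁ ↔ a' ∈ u i₀) → (a ∈ u v₂ ↔ a ∈ u i₀) →
        (a' ∈ u v₂ ↔ a' ∉ u i₀) → ((u v₁).erase a).erase a' = ((u i₀).erase a).erase a' →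
        ((u v₂).erase a).erase a' = ((u i₀).erase a).erase a' →
        j₀ ≠ j₁ → j₀' ≠ j₁ → j₀' ≠ j₂ → j₂ ≠ j₁ →
        ((w j₁).erase c).erase c' = ((w j₀).erase c).erase c' →
        ((w j₂).erase c).erase c' = ((w j₀').erase c).erase c' →
        ((if c ∈ w j₁ then (1 : ℂ) else 0) - (if c ∈ w j₀ then 1 else 0)) *
            ((if c' ∈ w j₂ then (1 : ℂ) else 0) - (if c' ∈ w j₀' then 1 else 0)) ≠
          ((if c ∈ w j₂ then (1 : ℂ) else 0) - (if c ∈ w j₀' then 1 else 0)) *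
            ((if c' ∈ w j₁ then (1 : ℂ) else 0) - (if c' ∈ w j₀ then 1 else 0)) →
        ¬ (Set.InjOn (fun i => ((u i).erase a).erase a') {i | i ≠ v₁ ∧ i ≠ v₂} ∧
          Set.InjOn (fun j => ((w j).erase c).erase c') {j | j ≠ j₁ ∧ j ≠ j₂})) →
      (∀ (c c' a a' : Fin h) (j₀ v₁ v₂ i₀ i₀' i₁ i₂ : Fin r), c' ≠ c → a' ≠ a → v₁ ≠ j₀ → v₂ ≠ j₀ →
        v₂ ≠ v₁ → (c ∈ w v₁ ↔ c ∉ w j₀) → (c' ∈ w v₁ ↔ c' ∈ w j₀) → (c ∈ w v₂ ↔ c ∈ w j₀) →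
        (c' ∈ w v₂ ↔ c' ∉ w j₀) → ((w v₁).erase c).erase c' = ((w j₀).erase c).erase c' →
        ((w v₂).erase c).erase c' = ((w j₀).erase c).erase c' →
        i₀ ≠ i₁ → i₀' ≠ i₁ → i₀' ≠ i₂ → i₂ ≠ i₁ →
        ((u i₁).erase a).erase a' = ((u i₀).erase a).erase a' →
        ((u i₂).erase a).erase a' = ((u i₀').erase a).erase a' →
        ((if a ∈ u i₁ then (1 : ℂ) else 0) - (if a ∈ u i₀ then 1 else 0)) *
            ((if a' ∈ u i₂ then (1 : ℂ) else 0) - (if a' ∈ u i₀' then 1 else 0)) ≠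
          ((if a ∈ u i₂ then (1 : ℂ) else 0) - (if a ∈ u i₀' then 1 else 0)) *
            ((if a' ∈ u i₁ then (1 : ℂ) else 0) - (if a' ∈ u i₀ then 1 else 0)) →
        ¬ (Set.InjOn (fun j => ((w j).erase c).erase c') {j | j ≠ v₁ ∧ j ≠ v₂} ∧
          Set.InjOn (fun i => ((u i).erase a).erase a') {i | i ≠ i₁ ∧ i ≠ i₂})) →
      (∀ (a c : Fin h) (v₀ v₀' v₁ v₂ j₀ j₀' j₁ j₂ : Fin r), v₂ ≠ v₁ → a ∈ u v₁ → a ∈ u v₂ →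
        u v₀ = (u v₁).erase a → u v₀' = (u v₂).erase a → j₂ ≠ j₁ → j₀ ≠ j₁ → j₀' ≠ j₁ → j₀' ≠ j₂ →
        c ∈ w j₁ → c ∈ w j₂ → w j₀ = (w j₁).erase c → w j₀' = (w j₂).erase c →
        ¬ (Set.InjOn (fun i => (u i).erase a) {i | i ≠ v₁ ∧ i ≠ v₂} ∧
          Set.InjOn (fun j => (w j).erase c) {j | j ≠ j₁ ∧ j ≠ j₂})) →
      ∃ ℓ : Fin (h + h) → MvPolynomial (Fin (h + h)) ℂ, (∀ q, (ℓ q).totalDegree ≤ 1) ∧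
        (Matrix.of fun i j : Fin r => coeff
          (∑ b ∈ u i, Finsupp.single (Fin.castAdd h b) 1 + ∑ d ∈ w j, Finsupp.single (Fin.natAdd h d) 1)
          (∏ q, ℓ q)).det ≠ 0)
    (h r : ℕ) (u w : Fin r → Finset (Fin h)) (hu : Function.Injective u)
    (hw : Function.Injective w) :
    ∃ ℓ : Fin (h + h) → MvPolynomial (Fin (h + h)) ℂ, (∀ q, (ℓ q).totalDegree ≤ 1) ∧
      (Matrix.of fun i j : Fin r => coeff
        (∑ b ∈ u i, Finsupp.single (Fin.castAdd h b) 1 + ∑ d ∈ w j, Finsupp.single (Fin.natAdd h d) 1)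
        (∏ q, ℓ q)).det ≠ 0 :=
  chow_hit_of_twoEdgeCore_le core r h r le_rfl u w hu hw

end

end Summit.ValiantsHypothesis.ValiantsHypothesis.Theorems.BarrierLever.ChowFactor
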